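import Mathlib
import Summits.Parity.BatemanHorn.Theorems.PolynomialMobiusPolyMobiusTailStubPairMiddleBoxDispCore
import HarnessLib

/-!
# P2 `stub_pair_middle` — the per-box dispersion bound (stub `stub_pair_middle_boxdisp`)

STATUS (worker W13, 2026-08-17): complete (no sorries).  Lands as
`Summits/Parity/BatemanHorn/Theorems/PolynomialMobiusPolyMobiusTailStubPairMiddleBoxDisp.lean`;
the analytic part is the auxiliary stub `stub_pair_middle_boxdisp_core`
(`…StubPairMiddleBoxDispCore.lean`).

Auxiliary stub `stub_pair_middle_boxdisp` of the line `eta-free-multilinear-window` (crux `PolyMobiusTail`),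
the last input of the lead's assembly of `stub_pair_middle` (dispersion for the `k = 2` linear window).  For
the BOX-form sum `B(P,P',M_b,M_b') = ∑_{d₀ ∈ (P,P']} ∑_{d₁} ∑_{m ∈ (M_b,M_b']} [C1 ∧ C2' ∧ d₁ ∈ I ∧ C5]
μ(d₀)log d₀ · μ(d₁)log d₁` of the pair `(q₀X + a₀, q₁X + a₁)` (`C1: q₁ ∣ d₁m − a₁`, `C2': q₁d₀ ∣ q₀d₁m + Δ'`,
`C5: x^{σ₁} < d₀ ≤ x^{σ₂}`) this file performs the arithmetic rearrangement — squarefree support of `μ·log`,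
the split `d₀ = t·u` with `t = (d₀, N₀)`, `N₀ = |q₀||Δ'|q₁`, `u` coprime to `N₀` (a bijection onto
`u ∈ (U₁,U₂]`, squarefree, coprime to `|q₀||Δ'|q₁t`), the coprime splitting
`q₁tu ∣ E ⟺ q₁t ∣ E ∧ u ∣ E`, the classes of `(d₁, m)` modulo `Q = q₁t`
(`DispersionBox.sum_sum_ite_eq_sum_classes`) and the parametrisation `m = c_m + Qy`
(`DispersionBox.sum_Ioc_ite_modEq_eq_sum_Ioc`) — and applies `stub_pair_middle_boxdisp_core` to each of the
`≤ τ(N₀)·(q₁N₀)²` classes.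
-/

open scoped BigOperators
open Finset

namespace Summit.Parity.BatemanHorn.Theorems.PolyMobiusTail.EtaFreeWindow

open Literature.NumberTheory.Sieve
open Literature.NumberTheory.Sieve.DispersionBox


/-- Swapping a weighted outer sum inside a double sum. -/
theorem boxdisp_sum_mul_sum_sum_comm {α β γ : Type*} (U : Finset α) (D : Finset β) (M : Finset γ)
    (a : α → ℝ) (X : α → β → γ → ℝ) :
    ∑ u ∈ U, a u * ∑ d ∈ D, ∑ m ∈ M, X u d m = ∑ d ∈ D, ∑ m ∈ M, ∑ u ∈ U, a u * X u d m := by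
  calc ∑ u ∈ U, a u * ∑ d ∈ D, ∑ m ∈ M, X u d m
      = ∑ u ∈ U, ∑ d ∈ D, ∑ m ∈ M, a u * X u d m := by
        refine Finset.sum_congr rfl fun u _ => ?_
        rw [Finset.mul_sum]
        refine Finset.sum_congr rfl fun d _ => ?_
        rw [Finset.mul_sum]
    _ = ∑ d ∈ D, ∑ u ∈ U, ∑ m ∈ M, a u * X u d m := Finset.sum_comm
    _ = ∑ d ∈ D, ∑ m ∈ M, ∑ u ∈ U, a u * X u d m :=
        Finset.sum_congr rfl fun d _ => Finset.sum_comm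

/-- Swapping the parametrising sum past the weights. -/
theorem boxdisp_sum_mul_mul_comm {α γ : Type*} (U : Finset α) (Y : Finset γ) (c : ℝ) (b : α → ℝ)
    (X : α → γ → ℝ) :
    ∑ y ∈ Y, c * ∑ u ∈ U, b u * X u y = c * ∑ u ∈ U, b u * ∑ y ∈ Y, X u y := by
  calc ∑ y ∈ Y, c * ∑ u ∈ U, b u * X u y = ∑ y ∈ Y, ∑ u ∈ U, c * (b u * X u y) := by
        refine Finset.sum_congr rfl fun y _ => ?_
        rw [Finset.mul_sum]
    _ = ∑ u ∈ U, ∑ y ∈ Y, c * (b u * X u y) := Finset.sum_comm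
    _ = c * ∑ u ∈ U, b u * ∑ y ∈ Y, X u y := by
        simp only [Finset.mul_sum]

/-- A squarefree product `t·u` forces `u` to be coprime to every `n` whose common prime factors with `u`
divide `t`. -/
theorem boxdisp_coprime_of_squarefree_mul {t u n : ℕ} (hsq : Squarefree (t * u))
    (h : ∀ p : ℕ, p.Prime → p ∣ u → p ∣ n → p ∣ t) : Nat.Coprime u n := by
  refine Nat.coprime_of_dvd fun p hp hpu hpn => ?_
  have hpt := h p hp hpu hpn
  have h2 : p * p ∣ t * u := Nat.mul_dvd_mul hpt hpu
  have hu := hsq p h2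
  rw [Nat.isUnit_iff] at hu
  exact absurd hu hp.one_lt.ne'

/-- BOXDISP: per-box dispersion bound for the BOX-form sum (boxes in `(d₀, m)`, `d₁` in the
box-uniform interval), from the engine `stub_pair_middle_dispersion_engine` + the main-term bound
`DispersionMainTerm.abs_mainTerm_le` after `d₀ = t·u`, classes mod `q₁t`, dyadic `d₁`, Cauchy
(the analytic part is `stub_pair_middle_boxdisp_core`; here: the squarefree support of `μ·log`, the split
`d₀ = t·u` with `t = (d₀, N₀)`, `N₀ = |q₀||Δ'|q₁`, the coprime splitting of `q₁tu ∣ q₀d₁m + Δ'`, the classes of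
`(d₁, m)` modulo `Q = q₁t`, and the parametrisation `m = c_m + Qy`). -/
theorem stub_pair_middle_boxdisp :
    ∀ (q₀ a₀ q₁ a₁ : ℤ) (σ₁ σ₂ δ A : ℝ), 0 < q₀ → 0 < q₁ → q₁ * a₀ - q₀ * a₁ ≠ 0 →
      0 < σ₁ → σ₁ < σ₂ → σ₂ ≤ 1 → 0 < δ →
      ∃ K : ℝ, 0 < K ∧ ∃ x₀ : ℕ, ∀ x : ℕ, x₀ ≤ x → ∀ (θ η : ℝ) (Xb P P' Mb Mb' : ℕ),
        (x : ℝ) ^ σ₁ / 2 ≤ P → P < P' → 2 * P' ≤ 3 * P → (P' : ℝ) ≤ 2 * (x : ℝ) ^ σ₂ →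
        Mb < Mb' → Mb' ≤ Xb → P' ≤ Xb → (Xb : ℝ) ≤ (x : ℝ) ^ (2 : ℝ) →
        |∑ d₀ ∈ Finset.Ioc P P', ∑ d₁ ∈ Finset.Icc 1 Xb, ∑ m ∈ Finset.Ioc Mb Mb',
          (if ((d₁ : ℤ) * m - a₁) % q₁ = 0 ∧
              (q₁ * (d₀ : ℤ) ∣ q₀ * ((d₁ : ℤ) * m) + (q₁ * a₀ - q₀ * a₁)) ∧
              ((x : ℝ) ^ (1 - η) / P < (d₁ : ℝ) ∧ (d₁ : ℝ) ≤ (x : ℝ) ^ (1 + θ) / P' ∧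
                (d₁ : ℝ) ≤ ((q₁ : ℝ) * x + a₁) / Mb') ∧
              ((x : ℝ) ^ σ₁ < (d₀ : ℝ) ∧ (d₀ : ℝ) ≤ (x : ℝ) ^ σ₂) then
            ((ArithmeticFunction.moebius d₀ : ℝ) * Real.log d₀) *
              ((ArithmeticFunction.moebius d₁ : ℝ) * Real.log d₁) else 0)| ≤
        K * ((1 + Real.log x) ^ 4 * ((x : ℝ) / Mb') * ((Mb' : ℝ) - Mb + 1) ^ (1 / 2 : ℝ) +
             ((x : ℝ) / Mb') * ((Mb' : ℝ) - Mb + 1) / (1 + Real.log x) ^ A +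
             (x : ℝ) ^ δ * ((x : ℝ) / Mb') ^ (1 / 2 : ℝ) * ((Mb' : ℝ) - Mb + 1) +
             (x : ℝ) ^ δ * ((x : ℝ) ^ (1 + θ) / P') ^ (1 / 2 : ℝ) * (P' : ℝ) ^ (3 / 2 : ℝ)) := by
  intro q₀ a₀ q₁ a₁ σ₁ σ₂ δ A hq₀ hq₁ hΔ0 hσ₁ hσ₁₂ hσ₂ hδ
  obtain ⟨K₁, hK₁, x₀, hcore⟩ :=
    stub_pair_middle_boxdisp_core q₀ a₀ q₁ a₁ σ₁ σ₂ δ A hq₀ hq₁ hΔ0 hσ₁ hσ₁₂ hσ₂ hδ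
  set Δ : ℤ := q₁ * a₀ - q₀ * a₁ with hΔdef
  set N₀ : ℕ := q₀.natAbs * Δ.natAbs * q₁.toNat with hN₀
  have hq₁nat : (q₁.toNat : ℤ) = q₁ := Int.toNat_of_nonneg hq₁.le
  have hq₁N : 0 < q₁.toNat := by omega
  have hN₀pos : 0 < N₀ := by
    have h1 : 0 < q₀.natAbs := Int.natAbs_pos.mpr hq₀.ne'
    have h2 : 0 < Δ.natAbs := Int.natAbs_pos.mpr hΔ0
    positivity
  set Q₀ : ℕ := q₁.toNat * N₀ with hQ₀
  have hQ₀r : (0 : ℝ) ≤ Q₀ := Nat.cast_nonneg _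
  refine ⟨((Nat.divisors N₀).card : ℝ) * (Q₀ : ℝ) ^ 2 * K₁ + 1, by positivity, x₀, ?_⟩
  intro x hx θ η Xb P P' Mb Mb' hP hPP' hP'P hP'x hMb hMbX hP'X hXb
  have hcx := hcore x hx θ η Xb P P' Mb Mb' hP hPP' hP'P hP'x hMb hMbX hP'X hXb
  set F4 : ℝ := (1 + Real.log x) ^ 4 * ((x : ℝ) / Mb') * ((Mb' : ℝ) - Mb + 1) ^ (1 / 2 : ℝ) +
    ((x : ℝ) / Mb') * ((Mb' : ℝ) - Mb + 1) / (1 + Real.log x) ^ A +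
    (x : ℝ) ^ δ * ((x : ℝ) / Mb') ^ (1 / 2 : ℝ) * ((Mb' : ℝ) - Mb + 1) +
    (x : ℝ) ^ δ * ((x : ℝ) ^ (1 + θ) / P') ^ (1 / 2 : ℝ) * (P' : ℝ) ^ (3 / 2 : ℝ) with hF4
  -- `F4 ≥ 0` (from the core bound at `t = 1`)
  have h1div : (1 : ℕ) ∈ Nat.divisors N₀ := Nat.one_mem_divisors.mpr hN₀pos.ne'
  have hF4_0 : 0 ≤ F4 := by
    have h := hcx 1 q₁.toNat h1div (by rw [hq₁nat]; push_cast; ring) 0 0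
    have h' : K₁ * 0 ≤ K₁ * F4 := by rw [mul_zero]; exact (abs_nonneg _).trans h
    exact le_of_mul_le_mul_left h' hK₁
  have hKF : 0 ≤ K₁ * F4 := mul_nonneg hK₁.le hF4_0
  set w : ℕ → ℝ := fun n => (ArithmeticFunction.moebius n : ℝ) * Real.log n with hw
  have hw0 : ∀ n : ℕ, ¬Squarefree n → w n = 0 := fun n hn => by
    simp only [hw, ArithmeticFunction.moebius_eq_zero_of_not_squarefree hn, Int.cast_zero, zero_mul]
  /- ## Step 1: the squarefree support of `μ(d₀) log d₀` and the condition `C5` -/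
  have step1 : ∀ d₀ ∈ Finset.Ioc P P',
      (∑ d₁ ∈ Finset.Icc 1 Xb, ∑ m ∈ Finset.Ioc Mb Mb',
        (if ((d₁ : ℤ) * m - a₁) % q₁ = 0 ∧
            (q₁ * (d₀ : ℤ) ∣ q₀ * ((d₁ : ℤ) * m) + Δ) ∧
            ((x : ℝ) ^ (1 - η) / P < (d₁ : ℝ) ∧ (d₁ : ℝ) ≤ (x : ℝ) ^ (1 + θ) / P' ∧
              (d₁ : ℝ) ≤ ((q₁ : ℝ) * x + a₁) / Mb') ∧
            ((x : ℝ) ^ σ₁ < (d₀ : ℝ) ∧ (d₀ : ℝ) ≤ (x : ℝ) ^ σ₂) then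
          ((ArithmeticFunction.moebius d₀ : ℝ) * Real.log d₀) *
            ((ArithmeticFunction.moebius d₁ : ℝ) * Real.log d₁) else 0)) =
      if Squarefree d₀ ∧ ((x : ℝ) ^ σ₁ < (d₀ : ℝ) ∧ (d₀ : ℝ) ≤ (x : ℝ) ^ σ₂) then
        w d₀ * ∑ d₁ ∈ Finset.Icc 1 Xb, ∑ m ∈ Finset.Ioc Mb Mb',
          (if ((d₁ : ℤ) * m - a₁) % q₁ = 0 ∧
              (q₁ * (d₀ : ℤ) ∣ q₀ * ((d₁ : ℤ) * m) + Δ) ∧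
              ((x : ℝ) ^ (1 - η) / P < (d₁ : ℝ) ∧ (d₁ : ℝ) ≤ (x : ℝ) ^ (1 + θ) / P' ∧
                (d₁ : ℝ) ≤ ((q₁ : ℝ) * x + a₁) / Mb') then w d₁ else 0)
      else 0 := by
    intro d₀ _
    by_cases h5 : ((x : ℝ) ^ σ₁ < (d₀ : ℝ) ∧ (d₀ : ℝ) ≤ (x : ℝ) ^ σ₂)
    · by_cases hsq : Squarefree d₀
      · rw [if_pos ⟨hsq, h5⟩, Finset.mul_sum]
        refine Finset.sum_congr rfl fun d₁ _ => ?_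
        rw [Finset.mul_sum]
        refine Finset.sum_congr rfl fun m _ => ?_
        by_cases hc : ((d₁ : ℤ) * m - a₁) % q₁ = 0 ∧
            (q₁ * (d₀ : ℤ) ∣ q₀ * ((d₁ : ℤ) * m) + Δ) ∧
            ((x : ℝ) ^ (1 - η) / P < (d₁ : ℝ) ∧ (d₁ : ℝ) ≤ (x : ℝ) ^ (1 + θ) / P' ∧
              (d₁ : ℝ) ≤ ((q₁ : ℝ) * x + a₁) / Mb')
        · rw [if_pos ⟨hc.1, hc.2.1, hc.2.2, h5⟩, if_pos hc]
        · rw [if_neg (fun h => hc ⟨h.1, h.2.1, h.2.2.1⟩), if_neg hc, mul_zero]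
      · rw [if_neg (fun h => hsq h.1)]
        refine Finset.sum_eq_zero fun d₁ _ => Finset.sum_eq_zero fun m _ => ?_
        split_ifs
        · change w d₀ * w d₁ = 0
          rw [hw0 d₀ hsq, zero_mul]
        · rfl
    · rw [if_neg (fun h => h5 h.2)]
      refine Finset.sum_eq_zero fun d₁ _ => Finset.sum_eq_zero fun m _ => ?_
      rw [if_neg (fun h => h5 h.2.2.2)]
  rw [Finset.sum_congr rfl step1, ← Finset.sum_filter]
  /- ## Step 2: split according to `t = (d₀, N₀)` -/
  have hmaps : ∀ d₀ ∈ (Finset.Ioc P P').filter (fun d₀ : ℕ => Squarefree d₀ ∧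
      ((x : ℝ) ^ σ₁ < (d₀ : ℝ) ∧ (d₀ : ℝ) ≤ (x : ℝ) ^ σ₂)), Nat.gcd d₀ N₀ ∈ Nat.divisors N₀ :=
    fun d₀ _ => Nat.mem_divisors.mpr ⟨Nat.gcd_dvd_right _ _, hN₀pos.ne'⟩
  rw [← Finset.sum_fiberwise_of_maps_to hmaps]
  refine (Finset.abs_sum_le_sum_abs _ _).trans ?_
  -- it suffices to bound each `t`-part by `Q₀² K₁ F4`
  suffices hT : ∀ t ∈ Nat.divisors N₀,
      |∑ d₀ ∈ ((Finset.Ioc P P').filter (fun d₀ : ℕ => Squarefree d₀ ∧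
          ((x : ℝ) ^ σ₁ < (d₀ : ℝ) ∧ (d₀ : ℝ) ≤ (x : ℝ) ^ σ₂))).filter (fun d₀ : ℕ => Nat.gcd d₀ N₀ = t),
        w d₀ * ∑ d₁ ∈ Finset.Icc 1 Xb, ∑ m ∈ Finset.Ioc Mb Mb',
          (if ((d₁ : ℤ) * m - a₁) % q₁ = 0 ∧
              (q₁ * (d₀ : ℤ) ∣ q₀ * ((d₁ : ℤ) * m) + Δ) ∧
              ((x : ℝ) ^ (1 - η) / P < (d₁ : ℝ) ∧ (d₁ : ℝ) ≤ (x : ℝ) ^ (1 + θ) / P' ∧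
                (d₁ : ℝ) ≤ ((q₁ : ℝ) * x + a₁) / Mb') then w d₁ else 0)| ≤
        (Q₀ : ℝ) ^ 2 * (K₁ * F4) by
    refine (Finset.sum_le_sum hT).trans ?_
    rw [Finset.sum_const, nsmul_eq_mul]
    calc ((Nat.divisors N₀).card : ℝ) * ((Q₀ : ℝ) ^ 2 * (K₁ * F4))
        = (((Nat.divisors N₀).card : ℝ) * (Q₀ : ℝ) ^ 2 * K₁) * F4 := by ring
      _ ≤ (((Nat.divisors N₀).card : ℝ) * (Q₀ : ℝ) ^ 2 * K₁ + 1) * F4 :=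
          mul_le_mul_of_nonneg_right (by linarith) hF4_0
  intro t ht
  have htpos : 0 < t := Nat.pos_of_mem_divisors ht
  have htdvd : t ∣ N₀ := (Nat.mem_divisors.mp ht).1
  have htN : t ≤ N₀ := Nat.divisor_le ht
  have htr : (0 : ℝ) < t := by exact_mod_cast htpos
  set Qn : ℕ := q₁.toNat * t with hQn
  have hQnz : (Qn : ℤ) = q₁ * t := by rw [hQn]; push_cast; rw [hq₁nat]
  have hQnpos : 0 < Qn := by positivity
  have hQnQ₀ : (Qn : ℝ) ≤ Q₀ := by
    have : Qn ≤ Q₀ := Nat.mul_le_mul_left _ htN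
    exact_mod_cast this
  have hGt : q₀.natAbs * Δ.natAbs * Qn = N₀ * t := by rw [hQn, hN₀]; ring
  have hcxt := hcx t Qn ht hQnz
  /- ## Step 3: the non-squarefree `t` contribute nothing -/
  rcases (em (Squarefree t)).symm with hts | hts
  · rw [Finset.sum_eq_zero]
    · rw [abs_zero]; positivity
    intro d₀ hd₀
    exfalso
    simp only [Finset.mem_filter] at hd₀
    apply hts
    have h1 : t ∣ d₀ := hd₀.2 ▸ Nat.gcd_dvd_left d₀ N₀
    exact hd₀.1.2.1.squarefree_of_dvd h1
  /- ## Step 4: `d₀ = t · u` -/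
  set U₁ : ℕ := max (P / t) ⌊(x : ℝ) ^ σ₁ / t⌋₊ with hU₁
  set U₂ : ℕ := min (P' / t) ⌊(x : ℝ) ^ σ₂ / t⌋₊ with hU₂
  set Ut : Finset ℕ := (Finset.Ioc U₁ U₂).filter (fun u : ℕ =>
    Squarefree u ∧ Nat.Coprime u (q₀.natAbs * Δ.natAbs * Qn)) with hUt
  have hxσ₁0 : 0 ≤ (x : ℝ) ^ σ₁ / t := by positivity
  have hxσ₂0 : 0 ≤ (x : ℝ) ^ σ₂ / t := by positivity
  have hmemUt : ∀ u : ℕ, u ∈ Ut ↔ ((P < t * u ∧ (x : ℝ) ^ σ₁ < ((t * u : ℕ) : ℝ)) ∧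
      (t * u ≤ P' ∧ ((t * u : ℕ) : ℝ) ≤ (x : ℝ) ^ σ₂)) ∧ Squarefree u ∧
      (Nat.Coprime u N₀ ∧ Nat.Coprime u t) := by
    intro u
    rw [hUt, Finset.mem_filter, Finset.mem_Ioc, hU₁, hU₂, max_lt_iff, le_min_iff, hGt,
      Nat.coprime_mul_iff_right, Nat.div_lt_iff_lt_mul htpos, Nat.le_div_iff_mul_le htpos,
      Nat.floor_lt hxσ₁0, Nat.le_floor_iff hxσ₂0, div_lt_iff₀ htr, le_div_iff₀ htr]
    push_cast
    constructor
    · rintro ⟨⟨⟨h1, h2⟩, h3, h4⟩, h5, h6⟩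
      exact ⟨⟨⟨by linarith [Nat.mul_comm u t ▸ h1], by linarith⟩, by linarith [Nat.mul_comm u t ▸ h3], by linarith⟩, h5, h6⟩
    · rintro ⟨⟨⟨h1, h2⟩, h3, h4⟩, h5, h6⟩
      exact ⟨⟨⟨by linarith [Nat.mul_comm t u ▸ h1], by linarith⟩, by linarith [Nat.mul_comm t u ▸ h3], by linarith⟩, h5, h6⟩
  have step4 : ∑ d₀ ∈ ((Finset.Ioc P P').filter (fun d₀ : ℕ => Squarefree d₀ ∧
          ((x : ℝ) ^ σ₁ < (d₀ : ℝ) ∧ (d₀ : ℝ) ≤ (x : ℝ) ^ σ₂))).filter (fun d₀ : ℕ => Nat.gcd d₀ N₀ = t),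
        w d₀ * ∑ d₁ ∈ Finset.Icc 1 Xb, ∑ m ∈ Finset.Ioc Mb Mb',
          (if ((d₁ : ℤ) * m - a₁) % q₁ = 0 ∧
              (q₁ * (d₀ : ℤ) ∣ q₀ * ((d₁ : ℤ) * m) + Δ) ∧
              ((x : ℝ) ^ (1 - η) / P < (d₁ : ℝ) ∧ (d₁ : ℝ) ≤ (x : ℝ) ^ (1 + θ) / P' ∧
                (d₁ : ℝ) ≤ ((q₁ : ℝ) * x + a₁) / Mb') then w d₁ else 0) =
      ∑ u ∈ Ut, w (t * u) * ∑ d₁ ∈ Finset.Icc 1 Xb, ∑ m ∈ Finset.Ioc Mb Mb',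
          (if ((d₁ : ℤ) * m - a₁) % q₁ = 0 ∧
              (q₁ * ((t * u : ℕ) : ℤ) ∣ q₀ * ((d₁ : ℤ) * m) + Δ) ∧
              ((x : ℝ) ^ (1 - η) / P < (d₁ : ℝ) ∧ (d₁ : ℝ) ≤ (x : ℝ) ^ (1 + θ) / P' ∧
                (d₁ : ℝ) ≤ ((q₁ : ℝ) * x + a₁) / Mb') then w d₁ else 0) := by
    refine Finset.sum_nbij' (fun d₀ : ℕ => d₀ / t) (fun u : ℕ => t * u) ?_ ?_ ?_ ?_ ?_
    · intro d₀ hd₀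
      simp only [Finset.mem_filter, Finset.mem_Ioc] at hd₀
      obtain ⟨⟨⟨hP1, hP2⟩, hsq, h5a, h5b⟩, hg⟩ := hd₀
      have hdvd : t ∣ d₀ := hg ▸ Nat.gcd_dvd_left d₀ N₀
      have hd : t * (d₀ / t) = d₀ := Nat.mul_div_cancel' hdvd
      rw [hmemUt, hd]
      have hsq' : Squarefree (t * (d₀ / t)) := by rw [hd]; exact hsq
      refine ⟨⟨⟨hP1, h5a⟩, hP2, h5b⟩, Squarefree.of_mul_right hsq', ?_, ?_⟩
      · refine boxdisp_coprime_of_squarefree_mul hsq' fun p _ hpu hpN => ?_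
        rw [← hg]
        exact Nat.dvd_gcd (hpu.trans (Nat.div_dvd_of_dvd hdvd)) hpN
      · exact boxdisp_coprime_of_squarefree_mul hsq' fun p _ _ hpt => hpt
    · intro u hu
      obtain ⟨⟨⟨h1, h2⟩, h3, h4⟩, hsq, hcN, hct⟩ := (hmemUt u).mp hu
      simp only [Finset.mem_filter, Finset.mem_Ioc]
      refine ⟨⟨⟨h1, h3⟩, ?_, h2, h4⟩, ?_⟩
      · exact Nat.squarefree_mul_iff.mpr ⟨hct.symm, hts, hsq⟩
      · rw [Nat.Coprime.gcd_mul_right_cancel t hcN, Nat.gcd_eq_left htdvd]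
    · intro d₀ hd₀
      simp only [Finset.mem_filter] at hd₀
      exact Nat.mul_div_cancel' (hd₀.2 ▸ Nat.gcd_dvd_left d₀ N₀)
    · intro u _
      exact Nat.mul_div_cancel_left u htpos
    · intro d₀ hd₀
      simp only [Finset.mem_filter] at hd₀
      have hd : t * (d₀ / t) = d₀ := Nat.mul_div_cancel' (hd₀.2 ▸ Nat.gcd_dvd_left d₀ N₀)
      rw [hd]
  rw [step4]
  /- ## Step 5: the coprime splitting of `q₁tu ∣ E` and the reorganisation of the sums -/
  set fz : ℕ → ℤ → ℝ := fun d₁ mz => w d₁ * ∑ u ∈ Ut, w (t * u) *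
    (if (u : ℤ) ∣ q₀ * (d₁ : ℤ) * mz + Δ then (1 : ℝ) else 0) with hfz
  have hsplit : ∀ u ∈ Ut, ∀ d₁ m : ℕ,
      (q₁ * ((t * u : ℕ) : ℤ) ∣ q₀ * ((d₁ : ℤ) * m) + Δ) ↔
        ((Qn : ℤ) ∣ q₀ * (d₁ : ℤ) * (m : ℤ) + Δ) ∧ ((u : ℤ) ∣ q₀ * (d₁ : ℤ) * (m : ℤ) + Δ) := by
    intro u hu d₁ m
    obtain ⟨_, _, _, hct⟩ := (hmemUt u).mp hu
    have hcN : Nat.Coprime u N₀ := ((hmemUt u).mp hu).2.2.1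
    have hq₁dvd : q₁.toNat ∣ N₀ := ⟨q₀.natAbs * Δ.natAbs, by rw [hN₀]; ring⟩
    have hQu : Nat.Coprime Qn u :=
      Nat.Coprime.mul_left (Nat.Coprime.coprime_dvd_right hq₁dvd hcN).symm hct.symm
    have hcop : IsCoprime (Qn : ℤ) (u : ℤ) := Nat.isCoprime_iff_coprime.mpr hQu
    have he : q₁ * ((t * u : ℕ) : ℤ) = (Qn : ℤ) * u := by rw [hQnz]; push_cast; ring
    have hE : q₀ * ((d₁ : ℤ) * m) + Δ = q₀ * (d₁ : ℤ) * (m : ℤ) + Δ := by ring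
    rw [he, hE]
    exact ⟨fun h => ⟨dvd_of_mul_right_dvd h, dvd_of_mul_left_dvd h⟩, fun h => hcop.mul_dvd h.1 h.2⟩
  have e5 : ∑ u ∈ Ut, w (t * u) * ∑ d₁ ∈ Finset.Icc 1 Xb, ∑ m ∈ Finset.Ioc Mb Mb',
          (if ((d₁ : ℤ) * m - a₁) % q₁ = 0 ∧
              (q₁ * ((t * u : ℕ) : ℤ) ∣ q₀ * ((d₁ : ℤ) * m) + Δ) ∧
              ((x : ℝ) ^ (1 - η) / P < (d₁ : ℝ) ∧ (d₁ : ℝ) ≤ (x : ℝ) ^ (1 + θ) / P' ∧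
                (d₁ : ℝ) ≤ ((q₁ : ℝ) * x + a₁) / Mb') then w d₁ else 0) =
      ∑ d₁ ∈ (Finset.Icc 1 Xb).filter (fun d₁ : ℕ =>
          ((x : ℝ) ^ (1 - η) / P < (d₁ : ℝ) ∧ (d₁ : ℝ) ≤ (x : ℝ) ^ (1 + θ) / P' ∧
            (d₁ : ℝ) ≤ ((q₁ : ℝ) * x + a₁) / Mb')),
        ∑ m ∈ Finset.Ioc Mb Mb',
          (if ((d₁ : ℤ) * (m : ℤ) - a₁) % q₁ = 0 ∧ (Qn : ℤ) ∣ q₀ * (d₁ : ℤ) * (m : ℤ) + Δ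
            then fz d₁ (m : ℤ) else 0) := by
    rw [boxdisp_sum_mul_sum_sum_comm, Finset.sum_filter]
    refine Finset.sum_congr rfl fun d₁ _ => ?_
    by_cases hI : ((x : ℝ) ^ (1 - η) / P < (d₁ : ℝ) ∧ (d₁ : ℝ) ≤ (x : ℝ) ^ (1 + θ) / P' ∧
        (d₁ : ℝ) ≤ ((q₁ : ℝ) * x + a₁) / Mb')
    · rw [if_pos hI]
      refine Finset.sum_congr rfl fun m _ => ?_
      by_cases hPr : ((d₁ : ℤ) * (m : ℤ) - a₁) % q₁ = 0 ∧ (Qn : ℤ) ∣ q₀ * (d₁ : ℤ) * (m : ℤ) + Δ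
      · rw [if_pos hPr]
        simp only [hfz]
        rw [Finset.mul_sum]
        refine Finset.sum_congr rfl fun u hu => ?_
        by_cases hu' : (u : ℤ) ∣ q₀ * (d₁ : ℤ) * (m : ℤ) + Δ
        · rw [if_pos hu', if_pos ⟨hPr.1, (hsplit u hu d₁ m).mpr ⟨hPr.2, hu'⟩, hI⟩]; ring
        · rw [if_neg hu', if_neg (fun h => hu' ((hsplit u hu d₁ m).mp h.2.1).2)]; ring
      · rw [if_neg hPr]
        refine Finset.sum_eq_zero fun u hu => ?_
        rw [if_neg (fun h => hPr ⟨h.1, ((hsplit u hu d₁ m).mp h.2.1).1⟩), mul_zero]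
    · rw [if_neg hI]
      refine Finset.sum_eq_zero fun m _ => Finset.sum_eq_zero fun u _ => ?_
      rw [if_neg (fun h => hI h.2.2), mul_zero]
  rw [e5]
  /- ## Step 6: classes of `(d₁, m)` modulo `Q = q₁ t` -/
  have hq₁Q : (q₁ : ℤ) ∣ Qn := ⟨t, hQnz⟩
  have hPer : ∀ d m d' m' : ℤ, d ≡ d' [ZMOD Qn] → m ≡ m' [ZMOD Qn] →
      (((d * m - a₁) % q₁ = 0 ∧ (Qn : ℤ) ∣ q₀ * d * m + Δ) ↔
        ((d' * m' - a₁) % q₁ = 0 ∧ (Qn : ℤ) ∣ q₀ * d' * m' + Δ)) := by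
    intro d m d' m' hd hm
    have h1 : d * m - a₁ ≡ d' * m' - a₁ [ZMOD q₁] := ((hd.of_dvd hq₁Q).mul (hm.of_dvd hq₁Q)).sub_right _
    have h2 : q₀ * d * m + Δ ≡ q₀ * d' * m' + Δ [ZMOD Qn] := ((hd.mul_left q₀).mul hm).add_right _
    rw [Int.ModEq] at h1 h2
    rw [h1, Int.dvd_iff_emod_eq_zero, Int.dvd_iff_emod_eq_zero, h2]
  have hcls := sum_sum_ite_eq_sum_classes (M := ℝ) hQnpos
    ((Finset.Icc 1 Xb).filter (fun d₁ : ℕ =>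
      ((x : ℝ) ^ (1 - η) / P < (d₁ : ℝ) ∧ (d₁ : ℝ) ≤ (x : ℝ) ^ (1 + θ) / P' ∧
        (d₁ : ℝ) ≤ ((q₁ : ℝ) * x + a₁) / Mb')))
    (Finset.Ioc Mb Mb') (fun d m : ℤ => (d * m - a₁) % q₁ = 0 ∧ (Qn : ℤ) ∣ q₀ * d * m + Δ) hPer
    (fun d₁ m => fz d₁ (m : ℤ))
  beta_reduce at hcls
  rw [hcls]
  /- ## Step 7: parametrise `m = c_m + Qy` and apply the core bound -/
  refine (Finset.abs_sum_le_sum_abs _ _).trans ?_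
  refine (Finset.sum_le_sum fun cd _ => Finset.abs_sum_le_sum_abs _ _).trans ?_
  have hterm : ∀ cd ∈ Finset.range Qn, ∀ cm ∈ Finset.range Qn,
      |(if ((cd : ℤ) * (cm : ℤ) - a₁) % q₁ = 0 ∧ (Qn : ℤ) ∣ q₀ * (cd : ℤ) * (cm : ℤ) + Δ then
        ∑ d₁ ∈ ((Finset.Icc 1 Xb).filter (fun d₁ : ℕ =>
          ((x : ℝ) ^ (1 - η) / P < (d₁ : ℝ) ∧ (d₁ : ℝ) ≤ (x : ℝ) ^ (1 + θ) / P' ∧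
            (d₁ : ℝ) ≤ ((q₁ : ℝ) * x + a₁) / Mb'))).filter (fun d : ℕ => (d : ℤ) ≡ cd [ZMOD Qn]),
          ∑ m ∈ Finset.Ioc Mb Mb', (if (m : ℤ) ≡ cm [ZMOD Qn] then fz d₁ (m : ℤ) else 0)
        else 0)| ≤ K₁ * F4 := by
    intro cd _ cm _
    split_ifs with hP
    · rw [Finset.filter_filter]
      simp_rw [sum_Ioc_ite_modEq_eq_sum_Ioc hQnpos]
      simp only [hfz]
      simp_rw [boxdisp_sum_mul_mul_comm]
      exact hcxt (cd : ℤ) (cm : ℤ)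
    · rw [abs_zero]; exact hKF
  calc ∑ cd ∈ Finset.range Qn, ∑ cm ∈ Finset.range Qn,
        |(if ((cd : ℤ) * (cm : ℤ) - a₁) % q₁ = 0 ∧ (Qn : ℤ) ∣ q₀ * (cd : ℤ) * (cm : ℤ) + Δ then
          ∑ d₁ ∈ ((Finset.Icc 1 Xb).filter (fun d₁ : ℕ =>
            ((x : ℝ) ^ (1 - η) / P < (d₁ : ℝ) ∧ (d₁ : ℝ) ≤ (x : ℝ) ^ (1 + θ) / P' ∧
              (d₁ : ℝ) ≤ ((q₁ : ℝ) * x + a₁) / Mb'))).filter (fun d : ℕ => (d : ℤ) ≡ cd [ZMOD Qn]),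
            ∑ m ∈ Finset.Ioc Mb Mb', (if (m : ℤ) ≡ cm [ZMOD Qn] then fz d₁ (m : ℤ) else 0)
          else 0)|
      ≤ ∑ cd ∈ Finset.range Qn, ∑ cm ∈ Finset.range Qn, K₁ * F4 :=
        Finset.sum_le_sum fun cd hcd => Finset.sum_le_sum fun cm hcm => hterm cd hcd cm hcm
    _ = (Qn : ℝ) ^ 2 * (K₁ * F4) := by
        simp only [Finset.sum_const, Finset.card_range, nsmul_eq_mul]
        ring
    _ ≤ (Q₀ : ℝ) ^ 2 * (K₁ * F4) :=
        mul_le_mul_of_nonneg_right (pow_le_pow_left₀ (Nat.cast_nonneg _) hQnQ₀ 2) hKF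


end Summit.Parity.BatemanHorn.Theorems.PolyMobiusTail.EtaFreeWindow
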